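import Literature.MathematicalPhysics.QuantumFieldTheory.Balaban1983to89.B9SupplySockB9P3ZdLettersOmega

/-!
# `Balaban1983to89.B9SupplySockB9P3ZdOmega` — THE J-N06→N05 JUNCTION IN THE REPAIRED CURRENCY: [Balaban1985BackgroundPropagators] THEOREM 3.3
# (BY NAME, `B9.Thm33Printed`) AT THE `ℤᵈ × 𝔸` CARRIER SUPPLIES THE FOUR-LINE COLLAR SOCKET `SockB9P3D4` (B8 (1.59) lines 1–4 with the exterior-collar
# term of dag-n05-e's located repair R-d) at every member with `Margin2`, and Theorem 4's socket in dag-n05-e's repaired shape `SH59D`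

statement-level skeleton of published theorems with citation tags; proofs where landed; nothing here is a claim about the
Yang–Mills mass gap

PDF held: `paper:balaban1985-cmp99-regular-spaces-gauge-fixing` (B8; journal page = PDF page + 74), p. 77, p. 86 (1.55)–(1.59), p. 87 Prop. 3,
p. 88 Thm 4, p. 99 (1.131)–(1.133); `paper:balaban1985-cmp99-background-propagators` ([4] = B9; journal page = PDF page + 388), pp. 392–399, 404.

WHY THIS FILE (cell `pub-ymgap`, seat `pub-ymgap-dag-n06-b` g5, junction J-N06→N05; count-neutral).  The g4 junction `B9SupplySockB9P3Zd.
sockB9P3_allLevels_of_thm33` is VACUOUS as typed (`B8JunctionH59Vacuity.junction_hypotheses_unsatisfiable`, dag-n05-e g5): at the finite-`Ω₀`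
members of `ZdIdx d L` (the cube family `{□_j}` of (1.131)–(1.132), at which B8 Prop. 6 applies Thm 4 and Prop. 3) its letter binder `InvOnSupp`
claimed a left inverse of `Δ_a(U₀)` on fields living on the SIDES of the plaquettes touching `Ω₀` — more than print's `G(U) = (Ω₀Δ_aΩ₀)⁻¹`
((3.27) p. 395) provides — and the outer pure-gauge corner mode refutes the conclusion.  The located repair has two sides: dag-n05-e's R-d
re-typed the CONSUMER's sockets (`B8LeafModelZd3Bdry`, `B8Prop6CubeMember{Norms,Gauged}Bdry`: the (1.59) lines carry the level-0 collar term
`+ B_∂·Φ₀(A′)`, `Φ₀(A′) = sup_{b ∈ SideTouches(Ω₀) ∖ BondTouches(Ω₀)} η‖A′(b)‖`, bounded at the consumer by (1.66)₀); THIS FILE is the SUPPLIER's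
side: the junction re-run on print's field class E(Ω₀) (`B9SupplySockB9P3ZdLettersOmega`), delivering the four-line collar socket `SockB9P3D4` — and,
from it, Theorem 4's socket in dag-n05-e's exact repaired shape `SH59D` — from `B9.Thm33Printed` BY NAME.

THE PROOF (print's, p. 86, plus the tree's exterior bookkeeping).  For the socket datum (U₀, W = e^{iηA′}, A′ supported on the collar sides):
split `A′ = 𝟙_{Ω₀}A′ + (A′ − 𝟙_{Ω₀}A′)`.  The Ω₀-part is print's field: it lies in E(Ω₀), keeps (1.41) and the Landau condition ((1.38) reads the
Ω₀-bonds only), has the same averaging functional `|B₁|` (the averaging blocks lie in `Ω_j ⊆ Ω₀`), so (1.58) `𝟙_{Ω₀}A′ = G(U₀)J̃`, `J̃ = Ω₀Δ_a(U₀)𝟙_{Ω₀}A′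
= Ω₀(J(𝟙_{Ω₀}A′) + Δ′𝟙_{Ω₀}A′ + Q*aQ𝟙_{Ω₀}A′)` and Theorem 3.3's (3.47) entries at γ = −3 bound its (1.59) lines by `B₀|J̃|₍₋₃₎`, with `|J̃|₍₋₃₎ ≤
|J(𝟙_{Ω₀}A′)|₍₋₃₎ + c₆₉MK₆α₀|𝟙_{Ω₀}A′|₍₋₁₎ + q|B₁|` ((3.69), (3.16)) and the Neumann∕a-priori step of g4 (`apriori_arith`).  The outer part enters ONLY at
level 0 (margin of `Ω₁` inside `Ω₀`, `Margin2`): `|J(𝟙_{Ω₀}A′)|₍₋₃₎ ≤ |J(A′)|₍₋₃₎ + 16d·Φ₀`, `|A′|₍₋₁₎ ≤ |𝟙_{Ω₀}A′|₍₋₁₎ + Φ₀`, `|∇A′|₍₋₂₎ ≤ |∇𝟙_{Ω₀}A′|₍₋₂₎ +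
2Φ₀`, `|ΔA′|₍₋₃₎ ≤ |Δ𝟙_{Ω₀}A′|₍₋₃₎ + 4dΦ₀` (`B9SupplySockB9P3ZdLettersOmega` §3) — whence lines 1–4 with `B₀′ = max{1, 2B₀max{1,q}}` and the explicit
collar constant `B_∂ = (20d + 2)·B₀′`.

WHAT IS PROVED (kernel, 0 sorry, theorems only).  `collar_arith` (ℝ); `sockB9P3D4_at` (ONE member with `Margin2`, ONE level `m ≤ k`, block parameter
`M ≥ max{1,M₃}`, Theorem 3.3's (3.42)∕(3.46)∕(3.47) block for the member as the hypothesis `h33U`; explicit B₀′, B_∂, cP);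
★ `sockB9P3D4_allLevels_of_thm33` (`B9.Thm33Printed c35 geo bg Gp GA` BY NAME + `DictGlob` + `Prop6Feed` + the four E(Ω₀)-binders over ANY index map
`ι : J → ZdIdx d L` whose members have `Margin2` ⇒ `∃ B₀ cP`, ∀ j ∈ J, ∀ m ≤ k, `SockB9P3D4 L B₀′ ((20d+2)B₀′) cP …` with B₀′ = max{1, 2B₀max{1,q}});
★ `sockH59D_of_allLevelsD4` (n05-a's `B8LeafSocketsB9.sockH59_of_allLevels` VERBATIM in the repaired currency: the all-levels four-line collar
socket gives Theorem 4's socket in dag-n05-e's inline shape `SH59D` below `min cP (cP∕K₀)`, `K₀ = 10dL²B₀ + 320dLB₀B₀′`);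
★ `sh59D_cubeSubfamily_of_thm33` (the `SH59D` binder of `B8LeafModelZd3Bdry.thm4Printed_zd3_map_bdry` ∕ `B8Prop6CubeMemberGaugedBdry.
prop6Printed_zdCub_bdry₅` over the cube subtype of (1.131), SERVED: the cube families have `Margin2` since `R₁M₁ ≥ L ≥ 2`).

HONEST CENSUS.  (a) As in g4: lines 1, 2, 4 ⟸ (3.47)@−3 entries 0, 1, 3 of Theorem 3.3's block; line 3 = (1.55) with B₀′ ≥ 1; the Hölder line is NOT
supplied in the collar currency (not suppliable uniformly in `k` — docstring of `SockB9P3D4`); the clauses `WU₀ ∈ 𝔄`, «A′ Hermitian» unused; (3.35) fed by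
Prop. 6 (`Prop6Feed`); cP depends on Theorem 3.3's constants and M (served as `∃ cP > 0`); `d ≥ 2`, `L ≥ 1`.  (b) `B_∂ = (20d+2)·B₀′` is the TREE's
constant (print has no exterior data); the consumer's window `4B_∂ ≤ (dL − 1)B₀′` then reads `80d + 8 ≤ dL − 1`, i.e. `L ≥ 81 + 9∕d` — an «L large»
side condition of the tree's bookkeeping, stated, not hidden.  (c) NOT HERE (object-bound, N06): the letters as OPERATORS and `Thm33Printed` at a
genuine instance ([4] Sect. A (3.10)–(3.27), Thm 3.11).  (d) SATISFIABILITY of the hypothesis set: by print's objects at every member at which [4]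
Sect. A + Thm 3.3 hold (not claimed); the certified refutation (outer corner modes) is excluded from E(Ω₀) by construction; members with an empty
averaging set make `InvOnDom` + `AvgBoundDom` uninhabitable (print's Δ_a is not invertible there) — the consumer's Λb law excludes them.  Count-neutral;
N05∕N06 NOT discharged; one finite lattice programme; nothing continuum ∕ ℝ⁴ ∕ OS ∕ mass-gap ∕ Clay.  Unit `pub-ymgap-dag-n06-b` (g5), 2026-08-27.
-/

noncomputable section

open NormedSpace

namespace Literature.MathematicalPhysics.QuantumFieldTheory.Balaban1983to89.B9SupplySockB9P3ZdOmega

open Complex (I)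
open MatrixLog B7Prop1Explicit B7Prop2Explicit B7Prop1Local B7Eq92Concrete
open B7Prop4GeneralLevels (linCovIter)
open B8Ineq132 (covDerivFwd covDeriv InAk BondTouches)
open B8Eq119TwistedAxial (Restr129 InAx)
open B8Eq184Proof (cfgExp)
open B8Lemma1NonAbelian (mulCfg)
open B8Eq140Level (SideTouches)
open B8Eq146AExpansion (iEta plaqCovDeriv)
open B8Eq143PlaqExpansion (pdiv)
open B8Eq155JBound (Jcur wsup)
open B8ScaledSupNorm (bondNorm msup weight Bdd)
open B8Eq138LandauZd (IsLandau138 IsLandau138W logCfg covLap)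
open B8LeafModelZd (ZdIdx)
open B8Eq131CubesAdmissible (cubeFam)
open B8CubeMemberZd (cubeLamS cubeLamB)
open B8LeafModelZd3 (SockB9P3)
open B9Eq340HolderZd (hquot AdmPair)
open B9SupplySockB9P3ZdLetters (OpsZd deltaAOf DictGlob Prop6Feed HolderGlob)
open B9SupplySockB9P3ZdLettersOmega (OnDom restrictDom outerPart Margin2 InvOnDom CurvSmallDom LandauKillsDom AvgBoundDom SockB9P3D4)
open B8Prop3GaugeFixedKLevel (mem_unitaryUnits_of_mgauge_eq mulCfg_eq_gaugeAct_of_mgauge_eq)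

-- `Site` alone could resolve to the torus sites of `Setup.lean`; re-export the `ℤ^d` sites of `B7Prop1Explicit`.
export B7Prop1Explicit (Site)

variable {d : ℕ} {𝔸 : Type*} [CStarAlgebra 𝔸]

/-! ## §1 The collar arithmetic -/

/-- **THE COLLAR ARITHMETIC**: an entry bounded by `B′(nJ + 16dΦ + nB) + eΦ` with `0 ≤ e ≤ 4d + 2`, `B′ ≥ 1`, `Φ ≥ 0` is bounded by
`B′(nJ + nB) + (20d + 2)B′Φ`. [cite: Balaban1985RegularSpaces, (1.59)–(1.60) p.86 (the tree's collar bookkeeping)] -/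
theorem collar_arith {x B' nJ nB Φ e : ℝ} {d : ℕ} (hB' : 1 ≤ B') (hΦ : 0 ≤ Φ) (he : e ≤ 4 * d + 2)
    (hx : x ≤ B' * (nJ + 16 * d * Φ + nB) + e * Φ) : x ≤ B' * (nJ + nB) + (20 * d + 2) * B' * Φ := by
  have hd0 : (0 : ℝ) ≤ 4 * d + 2 := by positivity
  have h1 : e * Φ ≤ (4 * d + 2) * B' * Φ := by
    have : e ≤ (4 * d + 2) * B' := by nlinarith
    exact mul_le_mul_of_nonneg_right this hΦ
  have h2 : B' * (nJ + 16 * d * Φ + nB) = B' * (nJ + nB) + 16 * d * (B' * Φ) := by ring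
  have h3 : (4 * d + 2) * B' * Φ + 16 * d * (B' * Φ) = (20 * d + 2) * B' * Φ := by ring
  linarith

/-! ## §2 The four-line collar socket at one member from Theorem 3.3's block -/

section Supply

variable [Nontrivial 𝔸]
variable {I : Type} (geo : I → B9.Geometry) (bg : I → B9.Backgrounds) (GA : ∀ i, B9.KernelFamily (geo i) (bg i))
variable (L : ℕ) (mem : ℝ → ZdIdx d L → ℕ → I)
variable (ιCfg : ∀ (M : ℝ) (i : ZdIdx d L) (m : ℕ) (U₀ : Site d → Fin d → 𝔸ˣ),
  (∀ x κ, U₀ x κ ∈ unitaryUnits 𝔸) → (bg (mem M i m)).Cfg)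
variable (ιLoc : ∀ (M : ℝ) (i : ZdIdx d L) (m : ℕ), (Site d → Fin d → 𝔸) → (geo (mem M i m)).Loc)
variable (ops : ℝ → ZdIdx d L → ℕ → OpsZd d 𝔸)

-- budget line (ops-buildfix standing ask for 100+-line weighted-norm proofs; elaborates well inside the default today)
set_option maxHeartbeats 400000 in
/-- **THEOREM 3.3 FOR G(U₀) AT ONE MEMBER WITH `Margin2` SUPPLIES THE FOUR-LINE COLLAR SOCKET AT THAT DATUM AND LEVEL** (B8 p. 86 «Theorem 3.3 of [4]
implies the bounds (1.59)», on print's field class E(Ω₀), with the located Δ′-transfer G-IF-01, the constant repair of `B8FromB9.b8_159_repaired`, and the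
tree's exterior bookkeeping).  Data: the [B9] frame with the member readings `DictGlob`, the E(Ω₀)-binders `InvOnDom`∕`CurvSmallDom`∕`LandauKillsDom`∕
`AvgBoundDom`, Prop. 6 `Prop6Feed`, a block parameter `M ≥ max{1, M₃}`, a member `i` whose domain sequence has `Margin2`, a level `m ≤ k`, and THEOREM
3.3's (3.42)∕(3.46)∕(3.47) block of the member `(M, i, m)` as the hypothesis `h33U`.  Conclusion: `SockB9P3D4` at level `m` with B₀′ = max{1, 2B₀max{1,q}},
B_∂ = (20d + 2)B₀′, cP = min{1∕16, c₆∕M, a₀∕(K₆M), a₃∕(K₆M), 1∕(2B₀c₆₉K₆M + 1)}.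
[cite: Balaban1985RegularSpaces, (1.58)–(1.59) p.86, Prop. 3 p.87, p.77; Balaban1985BackgroundPropagators, Thm 3.3 p.399, (3.26)–(3.27) p.395, (3.47) p.398, (3.69) p.404] -/
theorem sockB9P3D4_at (hd2 : 2 ≤ d) (hL : 1 ≤ L) {c35 c₆ K₆ M₃ a₃ c69 q : ℝ}
    (hdict : DictGlob geo bg GA L mem ιCfg ιLoc ops) (hP6 : Prop6Feed bg L mem ιCfg c35 M₃ c₆ K₆)
    (hinv : InvOnDom bg L mem ιCfg ops c35 M₃ a₃) (hcurv : CurvSmallDom bg L mem ιCfg ops c35 M₃ a₃ c69)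
    (hlan : LandauKillsDom bg L mem ιCfg ops c35 M₃ a₃) (havg : AvgBoundDom L ops q)
    (hK₆ : 0 < K₆) (hc69 : 0 ≤ c69) (hq : 0 ≤ q)
    {M : ℝ} (hM1 : 1 ≤ M) (hM₃ : M₃ ≤ M) (i : ZdIdx d L) (hMi : Margin2 i.Ω) {m : ℕ} (hm : m ≤ i.k)
    {B₀ δ₀ a₀ : ℝ} (hB₀ : 0 < B₀)
    (h33U : ∀ (α₀ : ℝ) (U₀ : Site d → Fin d → 𝔸ˣ) (hU₀ : ∀ x κ, U₀ x κ ∈ unitaryUnits 𝔸), 0 < α₀ → M * α₀ ≤ a₀ →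
      (bg (mem M i m)).Reg335 c35 α₀ (ιCfg M i m U₀ hU₀) →
      B9.Ineq342_346_347 (GA (mem M i m)) B₀ δ₀ (ιCfg M i m U₀ hU₀)) :
    SockB9P3D4 (𝔸 := 𝔸) L (max 1 (2 * B₀ * max 1 q)) ((20 * d + 2) * max 1 (2 * B₀ * max 1 q))
      (min (1 / 16) (min (c₆ / M) (min (a₀ / (K₆ * M)) (min (a₃ / (K₆ * M)) (1 / (2 * B₀ * c69 * K₆ * M + 1))))))
      i.η m i.Ω i.Λs i.Λb := by
  intro α₀ α₂ hα₀ hα₀c hα₂ hα₂c U₀ W hU₀ hWu hInA _ hLanW A' _ h41 hA0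
  -- the thresholds
  have hη : 0 < i.η := i.hη
  have hLr : (1 : ℝ) ≤ L := by exact_mod_cast hL
  have hd1 : (1 : ℝ) ≤ d := by exact_mod_cast (le_trans (by norm_num) hd2 : 1 ≤ d)
  have hM0 : 0 < M := lt_of_lt_of_le one_pos hM1
  have hKM : 0 < K₆ * M := mul_pos hK₆ hM0
  simp only [le_min_iff] at hα₀c hα₂c
  obtain ⟨-, hα₀c6, hα₀a0, hα₀a3, hα₀θ⟩ := hα₀c
  obtain ⟨hα₂16, -, -, -, -⟩ := hα₂c
  have hc6 : M * α₀ ≤ c₆ := by rw [mul_comm]; exact (le_div_iff₀ hM0).1 hα₀c6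
  have ha₉0 : 0 < K₆ * α₀ := mul_pos hK₆ hα₀
  have ha0' : M * (K₆ * α₀) ≤ a₀ := by
    have h := (le_div_iff₀ hKM).1 hα₀a0
    calc M * (K₆ * α₀) = α₀ * (K₆ * M) := by ring
      _ ≤ a₀ := h
  have ha3' : M * (K₆ * α₀) ≤ a₃ := by
    have h := (le_div_iff₀ hKM).1 hα₀a3
    calc M * (K₆ * α₀) = α₀ * (K₆ * M) := by ring
      _ ≤ a₃ := h
  have hκ' : 0 ≤ c69 * M * (K₆ * α₀) := by positivity
  have hθ : B₀ * (c69 * M * (K₆ * α₀)) ≤ 1 / 2 := by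
    have hpos : 0 < 2 * B₀ * c69 * K₆ * M + 1 := by positivity
    have h1 : α₀ * (2 * B₀ * c69 * K₆ * M + 1) ≤ 1 := (le_div_iff₀ hpos).1 hα₀θ
    linarith [hα₀.le]
  -- (3.35) for U₀ by Proposition 6, and Theorem 3.3's (3.42)–(3.47) block for G(U₀)
  have hreg : (bg (mem M i m)).Reg335 c35 (K₆ * α₀) (ιCfg M i m U₀ hU₀) := hP6 M i m hM₃ α₀ U₀ hU₀ hα₀ hc6 hInA
  have h347 := h33U (K₆ * α₀) U₀ hU₀ ha₉0 ha0' hreg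
  obtain ⟨-, hd⟩ := hdict M i m
  have hU₀1 : ∀ x κ, U₀ x κ ∈ U1 𝔸 := fun x κ => unitaryUnits_le_U1 (hU₀ x κ)
  -- the datum and its restriction to the Ω₀-bonds
  have hAglob : ∀ (y : Site d) (τ : Fin d), ‖A' y τ‖ ≤ α₂ * i.η⁻¹ := by
    intro y τ
    by_cases hmem : ∃ j, j ≤ m ∧ SideTouches (i.Ω j) y τ
    · obtain ⟨j, hj, hs⟩ := hmem
      have hLj : (1 : ℝ) ≤ (L : ℝ) ^ j := one_le_pow₀ hLr
      calc ‖A' y τ‖ ≤ α₂ * ((L : ℝ) ^ j * i.η)⁻¹ := (h41 j hj y τ hs).2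
        _ = α₂ * i.η⁻¹ * ((L : ℝ) ^ j)⁻¹ := by rw [mul_inv]; ring
        _ ≤ α₂ * i.η⁻¹ * 1 := by
            apply mul_le_mul_of_nonneg_left (inv_le_one_of_one_le₀ hLj) (by positivity)
        _ = α₂ * i.η⁻¹ := mul_one _
    · rw [hA0 y τ fun j hj hs => hmem ⟨j, hj, hs⟩, norm_zero]
      positivity
  have hAbd : Bdd L m i.η (-(1 : ℝ)) (fun j (b : Site d × Fin d) => SideTouches (i.Ω j) b.1 b.2) (fun b => A' b.1 b.2) := by
    have e1 : (-(1 : ℝ)) = -((1 : ℕ) : ℝ) := by norm_num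
    rw [e1]
    refine B8ScaledSupNorm.bdd_of_forall (c := α₂) fun j hj b hb => ?_
    rw [B8ScaledSupNorm.weight_neg_natCast, pow_one]
    have h := (h41 j hj b.1 b.2 hb).2
    have hs : 0 < (L : ℝ) ^ j * i.η := B8ScaledSupNorm.scale_pos hL hη j
    calc (L : ℝ) ^ j * i.η * ‖A' b.1 b.2‖ ≤ (L : ℝ) ^ j * i.η * (α₂ * ((L : ℝ) ^ j * i.η)⁻¹) :=
          mul_le_mul_of_nonneg_left h hs.le
      _ = α₂ := by rw [mul_comm α₂, ← mul_assoc, mul_inv_cancel₀ hs.ne', one_mul]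
  obtain ⟨Ain, hAin_def⟩ : ∃ Ain : Site d → Fin d → 𝔸, Ain = restrictDom (i.Ω 0) A' := ⟨_, rfl⟩
  have h41b : ∀ j, j ≤ m → ∀ (y : Site d) (τ : Fin d), SideTouches (i.Ω j) y τ → ‖A' y τ‖ ≤ α₂ * ((L : ℝ) ^ j * i.η)⁻¹ :=
    fun j hj y τ hs => (h41 j hj y τ hs).2
  have hOn : OnDom L m i.η i.Ω Ain := by
    rw [hAin_def]; exact B9SupplySockB9P3ZdLettersOmega.onDom_restrictDom hL hη h41b
  have hAin_glob : ∀ (y : Site d) (τ : Fin d), ‖Ain y τ‖ ≤ α₂ * i.η⁻¹ := fun y τ => by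
    rw [hAin_def]; exact (B9SupplySockB9P3ZdLettersOmega.norm_restrictDom_le _ A' y τ).trans (hAglob y τ)
  obtain ⟨a, ha_def⟩ : ∃ a : ℝ,
      a = msup L m i.η (-(1 : ℝ)) (fun j (b : Site d × Fin d) => SideTouches (i.Ω j) b.1 b.2) (fun b => Ain b.1 b.2) := ⟨_, rfl⟩
  have ha0 : 0 ≤ a := by rw [ha_def]; exact B8ScaledSupNorm.msup_nonneg L m hη.le _ _ _
  -- the collar functional Φ₀ and the pointwise control of the outer part
  obtain ⟨Φ, hΦ_def⟩ : ∃ Φ : ℝ, Φ = msup L m i.η (-(1 : ℝ))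
      (fun j (b : Site d × Fin d) => j = 0 ∧ SideTouches (i.Ω 0) b.1 b.2 ∧ ¬ BondTouches (i.Ω 0) b.1 b.2) (fun b => A' b.1 b.2) := ⟨_, rfl⟩
  have hΦ0 : 0 ≤ Φ := by rw [hΦ_def]; exact B8ScaledSupNorm.msup_nonneg L m hη.le _ _ _
  have hbdΦ : Bdd L m i.η (-(1 : ℝ))
      (fun j (b : Site d × Fin d) => j = 0 ∧ SideTouches (i.Ω 0) b.1 b.2 ∧ ¬ BondTouches (i.Ω 0) b.1 b.2) (fun b => A' b.1 b.2) := by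
    have e1 : (-(1 : ℝ)) = -((1 : ℕ) : ℝ) := by norm_num
    rw [e1]
    exact B9SupplySockB9P3ZdLettersOmega.bdd_neg_of_pointwise hL hη 1 fun b => hAglob b.1 b.2
  have hout : ∀ (y : Site d) (τ : Fin d), ‖outerPart (i.Ω 0) A' y τ‖ ≤ i.η⁻¹ * Φ := by
    intro y τ; rw [hΦ_def]
    exact B9SupplySockB9P3ZdLettersOmega.norm_outerPart_le_phi hη hMi hA0 hbdΦ y τ
  -- the Landau condition for A′, hence for 𝟙_{Ω₀}A′; the source J̃ = Δ_a(U₀)𝟙_{Ω₀}A′ and 𝟙_{Ω₀}A′ = G(U₀)J̃ ((1.58))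
  have hLanA : IsLandau138 L m i.η (i.Ω 0) (i.Λs m) U₀ A' :=
    B9SupplySockB9P3Zd.landau_of_landauW hd2 hη U₀ hWu hα₂16 h41 hLanW
  have hLanAin : IsLandau138 L m i.η (i.Ω 0) (i.Λs m) U₀ Ain := by
    rw [hAin_def]; exact (B9SupplySockB9P3ZdLettersOmega.isLandau138_restrictDom_iff L m i.η (i.Ω 0) (i.Λs m) U₀ A').2 hLanA
  obtain ⟨Jt, hJt_def⟩ : ∃ Jt : Site d → Fin d → 𝔸, Jt = deltaAOf i.η (ops M i m) U₀ Ain := ⟨_, rfl⟩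
  have hGJ : (ops M i m).Gop U₀ Jt = Ain :=
    hinv M i m hM₃ (K₆ * α₀) U₀ hU₀ ha₉0 ha3' hreg Ain hOn Jt fun y τ _ => by rw [hJt_def]
  have hDRD : ∀ (x : Site d) (μ : Fin d), (ops M i m).DRDs U₀ Ain x μ = 0 :=
    hlan M i m hM₃ (K₆ * α₀) U₀ hU₀ ha₉0 ha3' hreg Ain hOn hLanAin
  have hJtb : ∀ (x : Site d) (μ : Fin d),
      Jt x μ = Jcur i.η U₀ Ain μ x + (ops M i m).Dp U₀ Ain x μ + (ops M i m).DRDs U₀ Ain x μ + (ops M i m).QQ U₀ Ain x μ := by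
    intro x μ; rw [hJt_def]; rfl
  -- the right-hand side quantities: |J|₍₋₃₎ of the datum, |J(𝟙_{Ω₀}A′)|₍₋₃₎, |B₁|
  obtain ⟨nJ, hnJ_def⟩ : ∃ nJ : ℝ, nJ = bondNorm L m i.η (-(3 : ℝ)) i.Ω (fun x μ => Jcur i.η U₀ A' μ x) := ⟨_, rfl⟩
  obtain ⟨nJi, hnJi_def⟩ : ∃ nJi : ℝ, nJi = bondNorm L m i.η (-(3 : ℝ)) i.Ω (fun x μ => Jcur i.η U₀ Ain μ x) := ⟨_, rfl⟩
  obtain ⟨nB, hnB_def⟩ : ∃ nB : ℝ, nB = wsup 1 (fun p : {p : ℕ × (Site d × Fin d) // p.1 ≤ m ∧ p.2 ∈ i.Λb m p.1} =>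
      linCovIter L U₀ (iEta i.η A') p.1.1 p.1.2.1 p.1.2.2) := ⟨_, rfl⟩
  have hnJ0 : 0 ≤ nJ := by rw [hnJ_def]; exact B8ScaledSupNorm.msup_nonneg L m hη.le _ _ _
  have hnB0 : 0 ≤ nB := by rw [hnB_def]; exact B8Eq155JBound.wsup_nonneg zero_le_one _
  have hnB_eq : wsup 1 (fun p : {p : ℕ × (Site d × Fin d) // p.1 ≤ m ∧ p.2 ∈ i.Λb m p.1} =>
      linCovIter L U₀ (iEta i.η Ain) p.1.1 p.1.2.1 p.1.2.2) = nB := by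
    rw [hnB_def, hAin_def]
    exact B9SupplySockB9P3ZdLettersOmega.wsupB1_restrictDom hL m i.η (B9SupplySockB9P3ZdLettersOmega.hbox_zero i hm) U₀ A'
  -- |J(𝟙_{Ω₀}A′)|₍₋₃₎ ≤ |J(A′)|₍₋₃₎ + 16dΦ (the outer part sits at level 0)
  have hnJi_le : nJi ≤ nJ + 16 * d * Φ := by
    rw [hnJi_def, hnJ_def, hAin_def]
    exact B9SupplySockB9P3ZdLettersOmega.bondNorm_jcur_restrict_le hL hη hMi hU₀1 hΦ0 hout hAglob
  -- the current of 𝟙_{Ω₀}A′ is bounded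
  have hgrad : ∀ (y : Site d) (κ τ : Fin d), ‖covDerivFwd i.η U₀ κ (fun z => Ain z τ) y‖ ≤ i.η⁻¹ * (α₂ * i.η⁻¹ + α₂ * i.η⁻¹) :=
    fun y κ τ => (B9SupplySockB9P3ZdLettersOmega.norm_covDerivFwd_le hη (hU₀1 _ _) _).trans
      (mul_le_mul_of_nonneg_left (add_le_add (hAin_glob _ _) (hAin_glob _ _)) (inv_nonneg.mpr hη.le))
  have hJbd : Bdd L m i.η (-(3 : ℝ)) (fun j (b : Site d × Fin d) => BondTouches (i.Ω j) b.1 b.2)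
      (fun b => Jcur i.η U₀ Ain b.2 b.1) :=
    B9SupplySockB9P3Zd.bdd_neg_three_of_pointwise hL hη fun b => B9SupplySockB9P3Zd.norm_Jcur_le_of_grad hη hU₀1 hgrad b.2 b.1
  -- |J̃|₍₋₃₎ ≤ |J(𝟙_{Ω₀}A′)|₍₋₃₎ + c₆₉ M α₀ |𝟙_{Ω₀}A′|₍₋₁₎ + q |B₁| (pointwise: (3.26) with (3.69), the Landau condition, (3.16))
  have hJt : bondNorm L m i.η (-(3 : ℝ)) i.Ω Jt ≤ nJi + c69 * M * (K₆ * α₀) * a + q * nB := by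
    have e3 : (-(3 : ℝ)) = -((3 : ℕ) : ℝ) := by norm_num
    have hnJi0 : 0 ≤ nJi := by rw [hnJi_def]; exact B8ScaledSupNorm.msup_nonneg L m hη.le _ _ _
    refine B8ScaledSupNorm.msup_le (by positivity) fun j hj b hb => ?_
    have hw : weight L i.η (-(3 : ℝ)) j = ((L : ℝ) ^ j * i.η) ^ 3 := by
      rw [e3, B8ScaledSupNorm.weight_neg_natCast]
    have hw0 : 0 ≤ ((L : ℝ) ^ j * i.η) ^ 3 := by positivity
    have h1 : weight L i.η (-(3 : ℝ)) j * ‖Jcur i.η U₀ Ain b.2 b.1‖ ≤ nJi := by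
      rw [hnJi_def]; exact B8ScaledSupNorm.weight_mul_norm_le_msup hJbd hj hb
    have h2 : ((L : ℝ) ^ j * i.η) ^ 3 * ‖(ops M i m).Dp U₀ Ain b.1 b.2‖ ≤ c69 * M * (K₆ * α₀) * a := by
      rw [ha_def]; exact hcurv M i m hM₃ (K₆ * α₀) U₀ hU₀ ha₉0 ha3' hreg Ain hOn j hj b.1 b.2 hb
    have h4 : ((L : ℝ) ^ j * i.η) ^ 3 * ‖(ops M i m).QQ U₀ Ain b.1 b.2‖ ≤ q * nB := by
      rw [← hnB_eq]; exact havg M i m U₀ hU₀ Ain hOn j hj b.1 b.2 hb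
    have hsum : ‖Jt b.1 b.2‖ ≤
        ‖Jcur i.η U₀ Ain b.2 b.1‖ + ‖(ops M i m).Dp U₀ Ain b.1 b.2‖ + ‖(ops M i m).QQ U₀ Ain b.1 b.2‖ := by
      rw [hJtb, hDRD b.1 b.2, add_zero]
      exact norm_add₃_le
    rw [hw] at h1 ⊢
    calc ((L : ℝ) ^ j * i.η) ^ 3 * ‖Jt b.1 b.2‖
        ≤ ((L : ℝ) ^ j * i.η) ^ 3 *
            (‖Jcur i.η U₀ Ain b.2 b.1‖ + ‖(ops M i m).Dp U₀ Ain b.1 b.2‖ + ‖(ops M i m).QQ U₀ Ain b.1 b.2‖) :=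
          mul_le_mul_of_nonneg_left hsum hw0
      _ = ((L : ℝ) ^ j * i.η) ^ 3 * ‖Jcur i.η U₀ Ain b.2 b.1‖ + ((L : ℝ) ^ j * i.η) ^ 3 * ‖(ops M i m).Dp U₀ Ain b.1 b.2‖ +
            ((L : ℝ) ^ j * i.η) ^ 3 * ‖(ops M i m).QQ U₀ Ain b.1 b.2‖ := by ring
      _ ≤ nJi + c69 * M * (K₆ * α₀) * a + q * nB := add_le_add (add_le_add h1 h2) h4
  -- Theorem 3.3's γ = −3 entries at J̃ through the dictionary ((3.47) ⇒ (1.59) for 𝟙_{Ω₀}A′)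
  obtain ⟨hw, hG0, hG1, hG3⟩ := hd U₀ hU₀ Jt
  have hline1 : a ≤ B₀ * bondNorm L m i.η (-(3 : ℝ)) i.Ω Jt := by
    have h := B9.glob_at_minus_three (GA (mem M i m)) h347 0 (ιLoc M i m Jt)
    rw [hG0, hw, hGJ, ← ha_def] at h
    exact h
  have hline2 : msup L m i.η (-(2 : ℝ)) (fun j (t : Fin d × Fin d × Site d) => SideTouches (i.Ω j) t.2.2 t.2.1)
      (fun t => covDerivFwd i.η U₀ t.1 (fun z => Ain z t.2.1) t.2.2) ≤ B₀ * bondNorm L m i.η (-(3 : ℝ)) i.Ω Jt := by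
    have h := B9.glob_at_minus_three (GA (mem M i m)) h347 1 (ιLoc M i m Jt)
    rw [hG1, hw, hGJ] at h
    exact h
  have hline4 : bondNorm L m i.η (-(3 : ℝ)) i.Ω (fun x μ => covLap i.η U₀ (fun z => Ain z μ) x) ≤
      B₀ * bondNorm L m i.η (-(3 : ℝ)) i.Ω Jt := by
    have h := B9.glob_at_minus_three (GA (mem M i m)) h347 3 (ιLoc M i m Jt)
    rw [hG3, hw, hGJ] at h
    exact h
  -- the a-priori (Neumann) step of G-IF-01 for 𝟙_{Ω₀}A′ with the source norm nJ + 16dΦ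
  have hN : bondNorm L m i.η (-(3 : ℝ)) i.Ω Jt ≤ (nJ + 16 * d * Φ) + c69 * M * (K₆ * α₀) * a + q * nB := by
    linarith only [hJt, hnJi_le]
  have hnJ1 : 0 ≤ nJ + 16 * d * Φ := by positivity
  obtain ⟨hA1, hA2, -, hA4, -⟩ := B9SupplySockB9P3Zd.apriori_arith (h := 0) (Cβ := 0) hB₀ hq hκ' hθ ha0 hnJ1 hnB0 le_rfl rfl hN hline1 hline2
    hline4 (by rw [zero_mul])
  -- bookkeeping constants
  obtain ⟨B', hB'_def⟩ : ∃ B' : ℝ, B' = max 1 (2 * B₀ * max 1 q) := ⟨_, rfl⟩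
  have hB'1 : 1 ≤ B' := by rw [hB'_def]; exact le_max_left _ _
  rw [← hB'_def] at hA1 hA2 hA4 ⊢
  -- the four lines for A′ = 𝟙_{Ω₀}A′ + outer part
  have hL1 : msup L m i.η (-(1 : ℝ)) (fun j (b : Site d × Fin d) => SideTouches (i.Ω j) b.1 b.2) (fun b => A' b.1 b.2) ≤ a + Φ := by
    rw [ha_def, hAin_def]
    exact B9SupplySockB9P3ZdLettersOmega.msup_side_le_restrict_add hη hMi hΦ0 hout hAbd
  have hL2 : msup L m i.η (-(2 : ℝ)) (fun j (t : Fin d × Fin d × Site d) => SideTouches (i.Ω j) t.2.2 t.2.1)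
      (fun t => covDerivFwd i.η U₀ t.1 (fun z => A' z t.2.1) t.2.2) ≤
      msup L m i.η (-(2 : ℝ)) (fun j (t : Fin d × Fin d × Site d) => SideTouches (i.Ω j) t.2.2 t.2.1)
        (fun t => covDerivFwd i.η U₀ t.1 (fun z => Ain z t.2.1) t.2.2) + 2 * Φ := by
    rw [hAin_def]
    exact B9SupplySockB9P3ZdLettersOmega.msup_grad_le_restrict_add hL hη hMi hU₀1 hΦ0 hout hAglob
  have hL4 : bondNorm L m i.η (-(3 : ℝ)) i.Ω (fun x μ => covLap i.η U₀ (fun z => A' z μ) x) ≤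
      bondNorm L m i.η (-(3 : ℝ)) i.Ω (fun x μ => covLap i.η U₀ (fun z => Ain z μ) x) + 4 * d * Φ := by
    rw [hAin_def]
    exact B9SupplySockB9P3ZdLettersOmega.bondNorm_covLap_le_restrict_add hL hη hMi hU₀1 hΦ0 hout hAglob
  have hJJ : bondNorm L m i.η (-(3 : ℝ)) i.Ω (fun x μ => pdiv i.η U₀ (plaqCovDeriv i.η U₀ A') μ x) = nJ := by
    rw [hnJ_def]; rfl
  -- name the remaining large terms, so that the final arithmetic runs on atoms
  obtain ⟨l1, hl1_def⟩ : ∃ l1 : ℝ,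
      l1 = msup L m i.η (-(1 : ℝ)) (fun j (b : Site d × Fin d) => SideTouches (i.Ω j) b.1 b.2) (fun b => A' b.1 b.2) := ⟨_, rfl⟩
  obtain ⟨l2, hl2_def⟩ : ∃ l2 : ℝ, l2 = msup L m i.η (-(2 : ℝ)) (fun j (t : Fin d × Fin d × Site d) => SideTouches (i.Ω j) t.2.2 t.2.1)
      (fun t => covDerivFwd i.η U₀ t.1 (fun z => A' z t.2.1) t.2.2) := ⟨_, rfl⟩
  obtain ⟨g2, hg2_def⟩ : ∃ g2 : ℝ, g2 = msup L m i.η (-(2 : ℝ)) (fun j (t : Fin d × Fin d × Site d) => SideTouches (i.Ω j) t.2.2 t.2.1)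
      (fun t => covDerivFwd i.η U₀ t.1 (fun z => Ain z t.2.1) t.2.2) := ⟨_, rfl⟩
  obtain ⟨l4, hl4_def⟩ : ∃ l4 : ℝ, l4 = bondNorm L m i.η (-(3 : ℝ)) i.Ω (fun x μ => covLap i.η U₀ (fun z => A' z μ) x) := ⟨_, rfl⟩
  obtain ⟨g4, hg4_def⟩ : ∃ g4 : ℝ, g4 = bondNorm L m i.η (-(3 : ℝ)) i.Ω (fun x μ => covLap i.η U₀ (fun z => Ain z μ) x) := ⟨_, rfl⟩
  rw [← hl1_def] at hL1
  rw [← hl2_def, ← hg2_def] at hL2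
  rw [← hg2_def] at hA2
  rw [← hl4_def, ← hg4_def] at hL4
  rw [← hg4_def] at hA4
  rw [← hnJ_def, ← hnB_def, ← hΦ_def, hJJ, ← hl1_def, ← hl2_def, ← hl4_def]
  have hd4 : (1 : ℝ) ≤ 4 * d + 2 := by linarith only [hd1]
  refine ⟨?_, ?_, ?_, ?_⟩
  · exact collar_arith (e := 1) hB'1 hΦ0 hd4 (by linarith only [hL1, hA1])
  · exact collar_arith (e := 2) hB'1 hΦ0 (by linarith only [hd1]) (by linarith only [hL2, hA2])
  · refine collar_arith (e := 0) hB'1 hΦ0 (by linarith only [hd1]) ?_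
    have h1 : nJ ≤ B' * nJ := le_mul_of_one_le_left hnJ0 hB'1
    have h2 : 0 ≤ B' * (16 * d * Φ + nB) := by positivity
    calc nJ ≤ B' * nJ := h1
      _ ≤ B' * nJ + B' * (16 * d * Φ + nB) := le_add_of_nonneg_right h2
      _ = B' * (nJ + 16 * d * Φ + nB) + 0 * Φ := by ring
  · exact collar_arith (e := 4 * d) hB'1 hΦ0 (by linarith only [hd1]) (by linarith only [hL4, hA4])

/-! ## §3 The ORIGINAL five-line socket at a member with `Ω₀ = ℤᵈ` (no exterior data) -/

-- budget line (ops-buildfix standing ask for 100+-line weighted-norm proofs; elaborates well inside the default today)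
set_option maxHeartbeats 400000 in
/-- **AT A MEMBER WITH `Ω₀ = ℤᵈ` THEOREM 3.3 SUPPLIES THE ORIGINAL FIVE-LINE SOCKET `SockB9P3`** (print's family `(T, □₁, …, □_k)`, B8 p. 77 «we
admit the case where some domains Ω_j are equal to T_η»; every bond is a bond of `Ω₀`, so E(Ω₀) is the consumer's class and there is no exterior
data) — g4's `B9SupplySockB9P3Zd.sockB9P3_at` re-run on the E(Ω₀)-binders, with the Hölder line from `HolderGlob` and both blocks of Theorem 3.3 at
the member.  The supplier shape of the `SB9all` binder of the N05 record knit (dag-n05-d `…N05SubBHKnitUnivT8Srv`, keyed on `i.Ω 0 = Set.univ`).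
[cite: Balaban1985RegularSpaces, (1.58)–(1.59) p.86, Prop. 3 p.87, p.77; Balaban1985BackgroundPropagators, Thm 3.3 p.399, (3.26)–(3.27) p.395, (3.43), (3.47) p.398, (3.69) p.404] -/
theorem sockB9P3_at_univ (hd2 : 2 ≤ d) (hL : 1 ≤ L) {c35 c₆ K₆ M₃ a₃ c69 q CH β : ℝ} {len : Site d → ℝ}
    (hdict : DictGlob geo bg GA L mem ιCfg ιLoc ops) (hP6 : Prop6Feed bg L mem ιCfg c35 M₃ c₆ K₆)
    (hinv : InvOnDom bg L mem ιCfg ops c35 M₃ a₃) (hcurv : CurvSmallDom bg L mem ιCfg ops c35 M₃ a₃ c69)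
    (hlan : LandauKillsDom bg L mem ιCfg ops c35 M₃ a₃) (havg : AvgBoundDom L ops q)
    (hhol : HolderGlob geo bg GA L mem ιCfg ops β len CH)
    (hK₆ : 0 < K₆) (hc69 : 0 ≤ c69) (hq : 0 ≤ q)
    {M : ℝ} (hM1 : 1 ≤ M) (hM₃ : M₃ ≤ M) (i : ZdIdx d L) (hΩ : i.Ω 0 = Set.univ) (m : ℕ)
    {B₀ δ₀ a₀ : ℝ} {Bβ Bε : ℝ → ℝ} {Bεβ : ℝ → ℝ → ℝ} (hB₀ : 0 < B₀)
    (h33U : ∀ (α₀ : ℝ) (U₀ : Site d → Fin d → 𝔸ˣ) (hU₀ : ∀ x κ, U₀ x κ ∈ unitaryUnits 𝔸), 0 < α₀ → M * α₀ ≤ a₀ →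
      (bg (mem M i m)).Reg335 c35 α₀ (ιCfg M i m U₀ hU₀) →
      B9.Ineq342_346_347 (GA (mem M i m)) B₀ δ₀ (ιCfg M i m U₀ hU₀) ∧
        B9.Ineq343_345 (GA (mem M i m)) Bβ Bε Bεβ δ₀ (ιCfg M i m U₀ hU₀)) :
    SockB9P3 (𝔸 := 𝔸) L (max 1 (2 * B₀ * max 1 q)) (2 * max 0 (CH * Bβ β) * max 1 q)
      (min (1 / 16) (min (c₆ / M) (min (a₀ / (K₆ * M)) (min (a₃ / (K₆ * M)) (1 / (2 * B₀ * c69 * K₆ * M + 1))))))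
      β len i.η m i.Ω i.Λs i.Λb := by
  intro α₀ α₂ hα₀ hα₀c hα₂ hα₂c U₀ W hU₀ hWu hInA _ hLanW A' _ h41 hA0
  -- the thresholds
  have hη : 0 < i.η := i.hη
  have hLr : (1 : ℝ) ≤ L := by exact_mod_cast hL
  have hM0 : 0 < M := lt_of_lt_of_le one_pos hM1
  have hKM : 0 < K₆ * M := mul_pos hK₆ hM0
  simp only [le_min_iff] at hα₀c hα₂c
  obtain ⟨-, hα₀c6, hα₀a0, hα₀a3, hα₀θ⟩ := hα₀c
  obtain ⟨hα₂16, -, -, -, -⟩ := hα₂c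
  have hc6 : M * α₀ ≤ c₆ := by rw [mul_comm]; exact (le_div_iff₀ hM0).1 hα₀c6
  have ha₉0 : 0 < K₆ * α₀ := mul_pos hK₆ hα₀
  have ha0' : M * (K₆ * α₀) ≤ a₀ := by
    have h := (le_div_iff₀ hKM).1 hα₀a0
    calc M * (K₆ * α₀) = α₀ * (K₆ * M) := by ring
      _ ≤ a₀ := h
  have ha3' : M * (K₆ * α₀) ≤ a₃ := by
    have h := (le_div_iff₀ hKM).1 hα₀a3
    calc M * (K₆ * α₀) = α₀ * (K₆ * M) := by ring
      _ ≤ a₃ := h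
  have hκ' : 0 ≤ c69 * M * (K₆ * α₀) := by positivity
  have hθ : B₀ * (c69 * M * (K₆ * α₀)) ≤ 1 / 2 := by
    have hpos : 0 < 2 * B₀ * c69 * K₆ * M + 1 := by positivity
    have h1 : α₀ * (2 * B₀ * c69 * K₆ * M + 1) ≤ 1 := (le_div_iff₀ hpos).1 hα₀θ
    linarith [hα₀.le]
  -- (3.35) for U₀ by Proposition 6, and Theorem 3.3's blocks for G(U₀)
  have hreg : (bg (mem M i m)).Reg335 c35 (K₆ * α₀) (ιCfg M i m U₀ hU₀) := hP6 M i m hM₃ α₀ U₀ hU₀ hα₀ hc6 hInA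
  obtain ⟨h347, h345⟩ := h33U (K₆ * α₀) U₀ hU₀ ha₉0 ha0' hreg
  obtain ⟨-, hd⟩ := hdict M i m
  -- A′ is a field of the class E(Ω₀) = E (every bond is a bond of Ω₀ = ℤᵈ)
  have hU₀1 : ∀ x κ, U₀ x κ ∈ U1 𝔸 := fun x κ => unitaryUnits_le_U1 (hU₀ x κ)
  have hBT : ∀ (y : Site d) (τ : Fin d), BondTouches (i.Ω 0) y τ := fun y τ => Or.inl (by rw [hΩ]; exact Set.mem_univ y)
  have hAbd : Bdd L m i.η (-(1 : ℝ)) (fun j (b : Site d × Fin d) => SideTouches (i.Ω j) b.1 b.2) (fun b => A' b.1 b.2) := by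
    have e1 : (-(1 : ℝ)) = -((1 : ℕ) : ℝ) := by norm_num
    rw [e1]
    refine B8ScaledSupNorm.bdd_of_forall (c := α₂) fun j hj b hb => ?_
    rw [B8ScaledSupNorm.weight_neg_natCast, pow_one]
    have h := (h41 j hj b.1 b.2 hb).2
    have hs : 0 < (L : ℝ) ^ j * i.η := B8ScaledSupNorm.scale_pos hL hη j
    calc (L : ℝ) ^ j * i.η * ‖A' b.1 b.2‖ ≤ (L : ℝ) ^ j * i.η * (α₂ * ((L : ℝ) ^ j * i.η)⁻¹) :=
          mul_le_mul_of_nonneg_left h hs.le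
      _ = α₂ := by rw [mul_comm α₂, ← mul_assoc, mul_inv_cancel₀ hs.ne', one_mul]
  have hOn : OnDom L m i.η i.Ω A' := ⟨fun y τ h => absurd (hBT y τ) h, hAbd⟩
  obtain ⟨a, ha_def⟩ : ∃ a : ℝ,
      a = msup L m i.η (-(1 : ℝ)) (fun j (b : Site d × Fin d) => SideTouches (i.Ω j) b.1 b.2) (fun b => A' b.1 b.2) :=
    ⟨_, rfl⟩
  have ha0 : 0 ≤ a := by rw [ha_def]; exact B8ScaledSupNorm.msup_nonneg L m hη.le _ _ _
  -- the Landau condition for A′; the source J̃ = Δ_a(U₀)A′ and A′ = G(U₀)J̃ ((1.58))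
  have hLanA : IsLandau138 L m i.η (i.Ω 0) (i.Λs m) U₀ A' := B9SupplySockB9P3Zd.landau_of_landauW hd2 hη U₀ hWu hα₂16 h41 hLanW
  obtain ⟨Jt, hJt_def⟩ : ∃ Jt : Site d → Fin d → 𝔸, Jt = deltaAOf i.η (ops M i m) U₀ A' := ⟨_, rfl⟩
  have hGJ : (ops M i m).Gop U₀ Jt = A' :=
    hinv M i m hM₃ (K₆ * α₀) U₀ hU₀ ha₉0 ha3' hreg A' hOn Jt fun y τ _ => by rw [hJt_def]
  have hDRD : ∀ (x : Site d) (μ : Fin d), (ops M i m).DRDs U₀ A' x μ = 0 :=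
    hlan M i m hM₃ (K₆ * α₀) U₀ hU₀ ha₉0 ha3' hreg A' hOn hLanA
  have hJtb : ∀ (x : Site d) (μ : Fin d),
      Jt x μ = Jcur i.η U₀ A' μ x + (ops M i m).Dp U₀ A' x μ + (ops M i m).DRDs U₀ A' x μ + (ops M i m).QQ U₀ A' x μ := by
    intro x μ; rw [hJt_def]; rfl
  -- the right-hand side of the socket: |J|₍₋₃₎ and |B₁|
  obtain ⟨nJ, hnJ_def⟩ : ∃ nJ : ℝ, nJ = bondNorm L m i.η (-(3 : ℝ)) i.Ω (fun x μ => Jcur i.η U₀ A' μ x) := ⟨_, rfl⟩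
  obtain ⟨nB, hnB_def⟩ : ∃ nB : ℝ, nB = wsup 1 (fun p : {p : ℕ × (Site d × Fin d) // p.1 ≤ m ∧ p.2 ∈ i.Λb m p.1} =>
      linCovIter L U₀ (iEta i.η A') p.1.1 p.1.2.1 p.1.2.2) := ⟨_, rfl⟩
  have hnJ0 : 0 ≤ nJ := by rw [hnJ_def]; exact B8ScaledSupNorm.msup_nonneg L m hη.le _ _ _
  have hnB0 : 0 ≤ nB := by rw [hnB_def]; exact B8Eq155JBound.wsup_nonneg zero_le_one _
  -- J is bounded (A′ is)
  have hAglob : ∀ (y : Site d) (τ : Fin d), ‖A' y τ‖ ≤ α₂ * i.η⁻¹ := by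
    intro y τ
    by_cases hmem : ∃ j, j ≤ m ∧ SideTouches (i.Ω j) y τ
    · obtain ⟨j, hj, hs⟩ := hmem
      have hLj : (1 : ℝ) ≤ (L : ℝ) ^ j := one_le_pow₀ hLr
      calc ‖A' y τ‖ ≤ α₂ * ((L : ℝ) ^ j * i.η)⁻¹ := (h41 j hj y τ hs).2
        _ = α₂ * i.η⁻¹ * ((L : ℝ) ^ j)⁻¹ := by rw [mul_inv]; ring
        _ ≤ α₂ * i.η⁻¹ * 1 := by
            apply mul_le_mul_of_nonneg_left (inv_le_one_of_one_le₀ hLj) (by positivity)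
        _ = α₂ * i.η⁻¹ := mul_one _
    · rw [hA0 y τ fun j hj hs => hmem ⟨j, hj, hs⟩, norm_zero]
      positivity
  have hgrad : ∀ (y : Site d) (κ τ : Fin d), ‖covDerivFwd i.η U₀ κ (fun z => A' z τ) y‖ ≤ i.η⁻¹ * (α₂ * i.η⁻¹ + α₂ * i.η⁻¹) :=
    fun y κ τ => (B9SupplySockB9P3ZdLettersOmega.norm_covDerivFwd_le hη (hU₀1 _ _) _).trans
      (mul_le_mul_of_nonneg_left (add_le_add (hAglob _ _) (hAglob _ _)) (inv_nonneg.mpr hη.le))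
  have hJbd : Bdd L m i.η (-(3 : ℝ)) (fun j (b : Site d × Fin d) => BondTouches (i.Ω j) b.1 b.2)
      (fun b => Jcur i.η U₀ A' b.2 b.1) :=
    B9SupplySockB9P3Zd.bdd_neg_three_of_pointwise hL hη fun b => B9SupplySockB9P3Zd.norm_Jcur_le_of_grad hη hU₀1 hgrad b.2 b.1
  -- |J̃|₍₋₃₎ ≤ |J|₍₋₃₎ + c₆₉ M α₀ |A′|₍₋₁₎ + q |B₁| (pointwise: (3.26) with (3.69), the Landau condition, (3.16))
  have hJt : bondNorm L m i.η (-(3 : ℝ)) i.Ω Jt ≤ nJ + c69 * M * (K₆ * α₀) * a + q * nB := by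
    have e3 : (-(3 : ℝ)) = -((3 : ℕ) : ℝ) := by norm_num
    refine B8ScaledSupNorm.msup_le (by positivity) fun j hj b hb => ?_
    have hw : weight L i.η (-(3 : ℝ)) j = ((L : ℝ) ^ j * i.η) ^ 3 := by
      rw [e3, B8ScaledSupNorm.weight_neg_natCast]
    have hw0 : 0 ≤ ((L : ℝ) ^ j * i.η) ^ 3 := by positivity
    have h1 : weight L i.η (-(3 : ℝ)) j * ‖Jcur i.η U₀ A' b.2 b.1‖ ≤ nJ := by
      rw [hnJ_def]; exact B8ScaledSupNorm.weight_mul_norm_le_msup hJbd hj hb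
    have h2 : ((L : ℝ) ^ j * i.η) ^ 3 * ‖(ops M i m).Dp U₀ A' b.1 b.2‖ ≤ c69 * M * (K₆ * α₀) * a := by
      rw [ha_def]; exact hcurv M i m hM₃ (K₆ * α₀) U₀ hU₀ ha₉0 ha3' hreg A' hOn j hj b.1 b.2 hb
    have h4 : ((L : ℝ) ^ j * i.η) ^ 3 * ‖(ops M i m).QQ U₀ A' b.1 b.2‖ ≤ q * nB := by
      rw [hnB_def]; exact havg M i m U₀ hU₀ A' hOn j hj b.1 b.2 hb
    have hsum : ‖Jt b.1 b.2‖ ≤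
        ‖Jcur i.η U₀ A' b.2 b.1‖ + ‖(ops M i m).Dp U₀ A' b.1 b.2‖ + ‖(ops M i m).QQ U₀ A' b.1 b.2‖ := by
      rw [hJtb, hDRD b.1 b.2, add_zero]
      exact norm_add₃_le
    rw [hw] at h1 ⊢
    calc ((L : ℝ) ^ j * i.η) ^ 3 * ‖Jt b.1 b.2‖
        ≤ ((L : ℝ) ^ j * i.η) ^ 3 *
            (‖Jcur i.η U₀ A' b.2 b.1‖ + ‖(ops M i m).Dp U₀ A' b.1 b.2‖ + ‖(ops M i m).QQ U₀ A' b.1 b.2‖) :=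
          mul_le_mul_of_nonneg_left hsum hw0
      _ = ((L : ℝ) ^ j * i.η) ^ 3 * ‖Jcur i.η U₀ A' b.2 b.1‖ + ((L : ℝ) ^ j * i.η) ^ 3 * ‖(ops M i m).Dp U₀ A' b.1 b.2‖ +
            ((L : ℝ) ^ j * i.η) ^ 3 * ‖(ops M i m).QQ U₀ A' b.1 b.2‖ := by ring
      _ ≤ nJ + c69 * M * (K₆ * α₀) * a + q * nB := add_le_add (add_le_add h1 h2) h4
  -- Theorem 3.3's γ = −3 entries at J̃ through the dictionary ((3.47) ⇒ (1.59)), and the Hölder binder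
  obtain ⟨hw, hG0, hG1, hG3⟩ := hd U₀ hU₀ Jt
  have hline1 : a ≤ B₀ * bondNorm L m i.η (-(3 : ℝ)) i.Ω Jt := by
    have h := B9.glob_at_minus_three (GA (mem M i m)) h347 0 (ιLoc M i m Jt)
    rw [hG0, hw, hGJ, ← ha_def] at h
    exact h
  have hline2 : msup L m i.η (-(2 : ℝ)) (fun j (t : Fin d × Fin d × Site d) => SideTouches (i.Ω j) t.2.2 t.2.1)
      (fun t => covDerivFwd i.η U₀ t.1 (fun z => A' z t.2.1) t.2.2) ≤ B₀ * bondNorm L m i.η (-(3 : ℝ)) i.Ω Jt := by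
    have h := B9.glob_at_minus_three (GA (mem M i m)) h347 1 (ιLoc M i m Jt)
    rw [hG1, hw, hGJ] at h
    exact h
  have hline4 : bondNorm L m i.η (-(3 : ℝ)) i.Ω (fun x μ => covLap i.η U₀ (fun z => A' z μ) x) ≤
      B₀ * bondNorm L m i.η (-(3 : ℝ)) i.Ω Jt := by
    have h := B9.glob_at_minus_three (GA (mem M i m)) h347 3 (ιLoc M i m Jt)
    rw [hG3, hw, hGJ] at h
    exact h
  have hline5 : msup L m i.η (-(2 + β))
      (fun j (q : Fin d × Fin d × (Site d × Site d)) => q.2.2 ∈ AdmPair i.η len ∧ q.2.2.1 ∈ i.Ω j)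
      (fun q => hquot i.η β len U₀ (covDerivFwd i.η U₀ q.1 (fun z => A' z q.2.1)) q.2.2) ≤
      max 0 (CH * Bβ β) * bondNorm L m i.η (-(3 : ℝ)) i.Ω Jt := by
    have h := hhol M i m Bβ Bε Bεβ δ₀ U₀ hU₀ h345 Jt
    rw [hGJ] at h
    exact h.trans (mul_le_mul_of_nonneg_right (le_max_right _ _) (B8ScaledSupNorm.msup_nonneg L m hη.le _ _ _))
  -- the a-priori (Neumann) step of G-IF-01, in the concrete norms
  have hJJ : bondNorm L m i.η (-(3 : ℝ)) i.Ω (fun x μ => pdiv i.η U₀ (plaqCovDeriv i.η U₀ A') μ x) = nJ := by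
    rw [hnJ_def]; rfl
  rw [← ha_def, ← hnJ_def, ← hnB_def]
  exact B9SupplySockB9P3Zd.apriori_arith hB₀ hq hκ' hθ ha0 hnJ0 hnB0 (le_max_left 0 _) hJJ hJt hline1 hline2 hline4 hline5

/-! ## §4 The family forms: Theorem 3.3 BY NAME (`B9.Thm33Printed`) over an index map -/

/-- ★ **[4] THEOREM 3.3 (BY NAME) SUPPLIES THE FOUR-LINE COLLAR SOCKET AT EVERY MEMBER WITH `Margin2` AND EVERY TRUNCATION LEVEL**:
`B9.Thm33Printed c35 geo bg Gp GA` for a [B9] frame reading the `ℤᵈ` data (`DictGlob`), with Proposition 6 in [4]'s shape (`Prop6Feed`) and the four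
E(Ω₀)-binders of B8 p. 86 (`InvOnDom`, `CurvSmallDom`, `LandauKillsDom`, `AvgBoundDom`), over ANY index map `ι : J → ZdIdx d L` whose members' domain
sequences have `Margin2` (the cube families of (1.131), `margin2_cubeFam`; the members with `Ω₀ = ℤᵈ`, `margin2_of_univ`), gives `B₀ > 0` (Theorem 3.3's),
`cP > 0` with `SockB9P3D4 L B₀′ ((20d+2)B₀′) cP …` at every `ι j` and every `m ≤ k`, B₀′ = max{1, 2B₀max{1,q}}; block parameter fixed at
`M = max{1, M₁, M₃}`.  The consumer chooses `J` (law-abiding members: dag-n05-c `IdxB8LawsB`; at members with an empty averaging set the binders are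
uninhabitable, as print's `Δ_a` is not invertible there). [cite: Balaban1985RegularSpaces, (1.59) p.86, Prop. 3 p.87, Thm 4 p.88, (1.131) p.99; Balaban1985BackgroundPropagators, Thm 3.3 p.399, (3.27) p.395] -/
theorem sockB9P3D4_allLevels_of_thm33 (hd2 : 2 ≤ d) (hL : 1 ≤ L) {c35 c₆ K₆ M₃ a₃ c69 q : ℝ}
    {Gp : ∀ i, B9.KernelFamily (geo i) (bg i)} (h33 : B9.Thm33Printed c35 geo bg Gp GA)
    (hdict : DictGlob geo bg GA L mem ιCfg ιLoc ops) (hP6 : Prop6Feed bg L mem ιCfg c35 M₃ c₆ K₆)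
    (hinv : InvOnDom bg L mem ιCfg ops c35 M₃ a₃) (hcurv : CurvSmallDom bg L mem ιCfg ops c35 M₃ a₃ c69)
    (hlan : LandauKillsDom bg L mem ιCfg ops c35 M₃ a₃) (havg : AvgBoundDom L ops q)
    (hc₆ : 0 < c₆) (hK₆ : 0 < K₆) (ha₃ : 0 < a₃) (hc69 : 0 ≤ c69) (hq : 0 ≤ q)
    {J : Type*} (ι : J → ZdIdx d L) (hMJ : ∀ j, Margin2 (ι j).Ω) :
    ∃ B₀ cP : ℝ, 0 < B₀ ∧ 0 < cP ∧
      ∀ (j : J) (m : ℕ), m ≤ (ι j).k →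
        SockB9P3D4 (𝔸 := 𝔸) L (max 1 (2 * B₀ * max 1 q)) ((20 * d + 2) * max 1 (2 * B₀ * max 1 q)) cP
          (ι j).η m (ι j).Ω (ι j).Λs (ι j).Λb := by
  obtain ⟨M₁, δ₀, a₀, B₀, Bβ, Bε, Bεβ, -, -, ha₀, hB₀, H⟩ := h33
  obtain ⟨M, hM_def⟩ : ∃ M : ℝ, M = max 1 (max M₁ M₃) := ⟨_, rfl⟩
  have hM1 : 1 ≤ M := by rw [hM_def]; exact le_max_left _ _
  have hMM₁ : M₁ ≤ M := by rw [hM_def]; exact (le_max_left _ _).trans (le_max_right _ _)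
  have hMM₃ : M₃ ≤ M := by rw [hM_def]; exact (le_max_right _ _).trans (le_max_right _ _)
  have hM0 : 0 < M := lt_of_lt_of_le one_pos hM1
  have hKM : 0 < K₆ * M := mul_pos hK₆ hM0
  refine ⟨B₀, min (1 / 16) (min (c₆ / M) (min (a₀ / (K₆ * M)) (min (a₃ / (K₆ * M)) (1 / (2 * B₀ * c69 * K₆ * M + 1))))),
    hB₀, ?_, fun j m hm => ?_⟩
  · refine lt_min (by norm_num) (lt_min (div_pos hc₆ hM0) (lt_min (div_pos ha₀ hKM) (lt_min (div_pos ha₃ hKM) ?_)))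
    have : 0 < 2 * B₀ * c69 * K₆ * M + 1 := by positivity
    positivity
  · refine sockB9P3D4_at geo bg GA L mem ιCfg ιLoc ops hd2 hL hdict hP6 hinv hcurv hlan havg hK₆ hc69 hq hM1 hMM₃ (ι j) (hMJ j) hm
      (δ₀ := δ₀) hB₀ fun α₀ U₀ hU₀ hα₀ hMa hreg => ?_
    have hMi : M₁ ≤ (geo (mem M (ι j) m)).M := by rw [(hdict M (ι j) m).1]; exact hMM₁
    have hMa' : (geo (mem M (ι j) m)).M * α₀ ≤ a₀ := by rw [(hdict M (ι j) m).1]; exact hMa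
    exact (H (mem M (ι j) m) hMi α₀ hα₀ hMa' (ιCfg M (ι j) m U₀ hU₀) hreg).2.1

/-- ★ **[4] THEOREM 3.3 (BY NAME) SUPPLIES THE ORIGINAL FIVE-LINE SOCKET AT EVERY MEMBER WITH `Ω₀ = ℤᵈ` AND EVERY TRUNCATION LEVEL** — the
non-vacuous successor of g4's `B9SupplySockB9P3Zd.sockB9P3_allLevels_of_thm33` for the `Ω₀ = ℤᵈ` members (print's `(T, □₁, …, □_k)`): `B9.Thm33Printed`
+ `DictGlob` + `Prop6Feed` + the four E(Ω₀)-binders + `HolderGlob`, over any index map `ι : J → ZdIdx d L` with `(ι j).Ω 0 = Set.univ`, give `B₀, B₀β, cP`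
with `SockB9P3 L B₀′ B₀β cP β len …` at every `ι j`, every `m ≤ k` — the `SB9all` binder of dag-n05-d's `…N05SubBHKnitUnivT8Srv` (keyed «`i.Ω 0 = Set.univ →
IdxB8LawsB L i → ∀ m ≤ i.k`») is this conclusion at `J :=` the law-abiding `Ω₀ = ℤᵈ` members.
[cite: Balaban1985RegularSpaces, (1.59) p.86, Prop. 3 p.87, Thm 4 p.88, p.77; Balaban1985BackgroundPropagators, Thm 3.3 p.399] -/
theorem sockB9P3_allLevels_of_thm33_univ (hd2 : 2 ≤ d) (hL : 1 ≤ L) {c35 c₆ K₆ M₃ a₃ c69 q CH β : ℝ} {len : Site d → ℝ}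
    {Gp : ∀ i, B9.KernelFamily (geo i) (bg i)} (h33 : B9.Thm33Printed c35 geo bg Gp GA)
    (hdict : DictGlob geo bg GA L mem ιCfg ιLoc ops) (hP6 : Prop6Feed bg L mem ιCfg c35 M₃ c₆ K₆)
    (hinv : InvOnDom bg L mem ιCfg ops c35 M₃ a₃) (hcurv : CurvSmallDom bg L mem ιCfg ops c35 M₃ a₃ c69)
    (hlan : LandauKillsDom bg L mem ιCfg ops c35 M₃ a₃) (havg : AvgBoundDom L ops q)
    (hhol : HolderGlob geo bg GA L mem ιCfg ops β len CH)
    (hc₆ : 0 < c₆) (hK₆ : 0 < K₆) (ha₃ : 0 < a₃) (hc69 : 0 ≤ c69) (hq : 0 ≤ q)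
    {J : Type*} (ι : J → ZdIdx d L) (hΩJ : ∀ j, (ι j).Ω 0 = Set.univ) :
    ∃ B₀ B₀β cP : ℝ, 0 < B₀ ∧ 0 ≤ B₀β ∧ 0 < cP ∧
      ∀ (j : J) (m : ℕ), m ≤ (ι j).k → SockB9P3 (𝔸 := 𝔸) L B₀ B₀β cP β len (ι j).η m (ι j).Ω (ι j).Λs (ι j).Λb := by
  obtain ⟨M₁, δ₀, a₀, B₀, Bβ, Bε, Bεβ, -, -, ha₀, hB₀, H⟩ := h33
  obtain ⟨M, hM_def⟩ : ∃ M : ℝ, M = max 1 (max M₁ M₃) := ⟨_, rfl⟩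
  have hM1 : 1 ≤ M := by rw [hM_def]; exact le_max_left _ _
  have hMM₁ : M₁ ≤ M := by rw [hM_def]; exact (le_max_left _ _).trans (le_max_right _ _)
  have hMM₃ : M₃ ≤ M := by rw [hM_def]; exact (le_max_right _ _).trans (le_max_right _ _)
  have hM0 : 0 < M := lt_of_lt_of_le one_pos hM1
  have hKM : 0 < K₆ * M := mul_pos hK₆ hM0
  refine ⟨max 1 (2 * B₀ * max 1 q), 2 * max 0 (CH * Bβ β) * max 1 q,
    min (1 / 16) (min (c₆ / M) (min (a₀ / (K₆ * M)) (min (a₃ / (K₆ * M)) (1 / (2 * B₀ * c69 * K₆ * M + 1))))),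
    lt_of_lt_of_le one_pos (le_max_left _ _), by positivity, ?_, fun j m _ => ?_⟩
  · refine lt_min (by norm_num) (lt_min (div_pos hc₆ hM0) (lt_min (div_pos ha₀ hKM) (lt_min (div_pos ha₃ hKM) ?_)))
    have : 0 < 2 * B₀ * c69 * K₆ * M + 1 := by positivity
    positivity
  · refine sockB9P3_at_univ geo bg GA L mem ιCfg ιLoc ops hd2 hL hdict hP6 hinv hcurv hlan havg hhol hK₆ hc69 hq hM1 hMM₃ (ι j) (hΩJ j) m
      (δ₀ := δ₀) (Bε := Bε) (Bεβ := Bεβ) hB₀ fun α₀ U₀ hU₀ hα₀ hMa hreg => ?_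
    have hMi : M₁ ≤ (geo (mem M (ι j) m)).M := by rw [(hdict M (ι j) m).1]; exact hMM₁
    have hMa' : (geo (mem M (ι j) m)).M * α₀ ≤ a₀ := by rw [(hdict M (ι j) m).1]; exact hMa
    exact (H (mem M (ι j) m) hMi α₀ hα₀ hMa' (ιCfg M (ι j) m U₀ hU₀) hreg).2

end Supply

/-! ## §5 Theorem 4's socket in the repaired currency (`SH59D`) from the all-levels four-line collar socket -/

section Bridge

variable [Nontrivial 𝔸]

/-- ★ **THEOREM 4's b9 SOCKET IN dag-n05-e's REPAIRED SHAPE `SH59D` FROM THE ALL-LEVELS FOUR-LINE COLLAR SOCKET** — n05-a's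
`B8LeafSocketsB9.sockH59_of_allLevels` VERBATIM in the repaired currency: below `min cP (cP ∕ K₀)`, `K₀ = 2L·5dLB₀ + 8·8B₀′·5dLB₀`, the datum `(u, W, A′)` of
Theorem 4's induction at level `m` (`u` unitary-valued and `= 1` off `Ω₀`, `W^{u} = U′`, the Landau condition of record at `m` levels, `A′` masked Hermitian with
`W = e^{iηA′}` and `‖A′‖ ≤ (2Lc⋆ + 8α₄)(Lʲη)⁻¹` on the collar sides) is a datum of `SockB9P3D4` at level `m` (`W` unitary-valued; `WU₀ = (U′U₀)^{u⁻¹} ∈ 𝔄` by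
gauge invariance; `U₀ ∈ 𝔄_m` by restriction of levels), and its two lines, exterior-collar term included, are the conclusion — EXACTLY the inline `SH59D`
hypothesis of `B8LeafModelZd3Bdry.thm4Body_member_zd3_bdry` ∕ `B8Thm4ConcreteBdry.thm4Body_concrete_uniform_bdry`.
[cite: Balaban1985RegularSpaces, (1.59) p.86, Thm 4 p.88 («the same conditions for k − 1»), (1.69) p.88, (1.133) p.99] -/
theorem sockH59D_of_allLevelsD4 (hd : 1 ≤ d) {L : ℕ} (hL : 1 ≤ L) {B₀ B₀' Bbd cP : ℝ} (hB₀ : 0 < B₀) (hB₀' : 0 ≤ B₀') (hcP : 0 < cP)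
    {η : ℝ} {k : ℕ} {Ω : ℕ → Set (Site d)} {Λs : ℕ → ℕ → Set (Site d)} {Λb : ℕ → ℕ → Set (Site d × Fin d)}
    (H : ∀ m, m ≤ k → SockB9P3D4 (𝔸 := 𝔸) L B₀ Bbd cP η m Ω Λs Λb) :
    ∀ α₀ α₁ : ℝ, 0 < α₀ → 0 < α₁ → α₀ + α₁ ≤ min cP (cP / (2 * (L * (5 * (d : ℝ) * L * B₀)) + 8 * (8 * B₀' * (5 * (d : ℝ) * L * B₀)))) →
      ∀ U₀ U' : Site d → Fin d → 𝔸ˣ, (∀ x κ, U₀ x κ ∈ unitaryUnits 𝔸) → (∀ x κ, U' x κ ∈ unitaryUnits 𝔸) →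
      InAk L k η α₀ Ω U₀ → InAk L k η α₀ Ω (mulCfg U' U₀) → (∀ m, m ≤ k → InAx L m (Λs m) U₀ (mulCfg U' U₀)) →
      (∀ j, j ≤ k → ∀ (z : Site d) (μ : Fin d), (∀ x, InBox (loK L j z) (bondHiK L j z μ) x → x ∈ Ω j) →
        ‖(avgIter L (mulCfg U' U₀) j z μ : 𝔸) - (avgIter L U₀ j z μ : 𝔸)‖ ≤ α₁) →
      (∀ b ∈ {b : Site d × Fin d | SideTouches (Ω 0) b.1 b.2}, ‖((U' b.1 b.2 : 𝔸ˣ) : 𝔸) - 1‖ ≤ α₁) →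
      (∀ m, 1 ≤ m → m ≤ k → ∀ (u : Site d → 𝔸ˣ) (W : Site d → Fin d → 𝔸ˣ) (A' : Site d → Fin d → 𝔸),
        (∀ x, u x ∈ unitaryUnits 𝔸) → (∀ x, x ∉ Ω 0 → u x = 1) → mgauge U₀ u W = U' → Restr129 L m (Λs m) U₀ u →
        IsLandau138W L m η (Ω 0) (Λs m) U₀ W → (∀ y τ, IsSelfAdjoint (A' y τ)) →
        (∀ j, j ≤ m → ∀ y τ, SideTouches (Ω j) y τ →
        W y τ = cfgExp η A' y τ ∧ ‖A' y τ‖ ≤ (2 * (L * (5 * (d : ℝ) * L * B₀ * (α₀ + α₁))) + 8 * (8 * B₀' * (5 * (d : ℝ) * L * B₀) * (α₀ + α₁))) * ((L : ℝ) ^ j * η)⁻¹) →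
        (∀ y τ, (∀ j, j ≤ m → ¬ SideTouches (Ω j) y τ) → A' y τ = 0) →
        msup L m η (-(1 : ℝ)) (fun j (b : Site d × Fin d) => SideTouches (Ω j) b.1 b.2) (fun b => A' b.1 b.2)
        ≤ B₀ * (bondNorm L m η (-(3 : ℝ)) Ω (fun x μ => Jcur η U₀ A' μ x)
        + wsup 1 (fun p : {p : ℕ × (Site d × Fin d) // p.1 ≤ m ∧ p.2 ∈ Λb m p.1} =>
        linCovIter L U₀ (iEta η A') p.1.1 p.1.2.1 p.1.2.2))
        + Bbd * msup L m η (-(1 : ℝ)) (fun j (b : Site d × Fin d) => j = 0 ∧ SideTouches (Ω 0) b.1 b.2 ∧ ¬ BondTouches (Ω 0) b.1 b.2)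
            (fun b => A' b.1 b.2) ∧
        msup L m η (-(2 : ℝ)) (fun j (t : Fin d × Fin d × Site d) => SideTouches (Ω j) t.2.2 t.2.1)
        (fun t => covDerivFwd η U₀ t.1 (fun z => A' z t.2.1) t.2.2)
        ≤ B₀ * (bondNorm L m η (-(3 : ℝ)) Ω (fun x μ => Jcur η U₀ A' μ x)
        + wsup 1 (fun p : {p : ℕ × (Site d × Fin d) // p.1 ≤ m ∧ p.2 ∈ Λb m p.1} =>
        linCovIter L U₀ (iEta η A') p.1.1 p.1.2.1 p.1.2.2))
        + Bbd * msup L m η (-(1 : ℝ)) (fun j (b : Site d × Fin d) => j = 0 ∧ SideTouches (Ω 0) b.1 b.2 ∧ ¬ BondTouches (Ω 0) b.1 b.2)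
            (fun b => A' b.1 b.2)) := by
  set K₀ : ℝ := 2 * (L * (5 * (d : ℝ) * L * B₀)) + 8 * (8 * B₀' * (5 * (d : ℝ) * L * B₀)) with hK₀_def
  have hL' : (1 : ℝ) ≤ L := by exact_mod_cast hL
  have hd' : (1 : ℝ) ≤ d := by exact_mod_cast hd
  have hK₀ : 0 < K₀ := by
    have h1 : 0 < 2 * (L * (5 * (d : ℝ) * L * B₀)) := by positivity
    have h2 : 0 ≤ 8 * (8 * B₀' * (5 * (d : ℝ) * L * B₀)) := by positivity
    linarith
  intro α₀ α₁ hα₀ hα₁ hs U₀ U' hU₀ hU' h33 h34 _ _ _ m _ hmk u W A' hu _ hW _ hLan hsa hWA hA0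
  -- the smallness constant of the datum and the guard of the level-`m` socket
  set K : ℝ := 2 * (L * (5 * (d : ℝ) * L * B₀ * (α₀ + α₁))) + 8 * (8 * B₀' * (5 * (d : ℝ) * L * B₀) * (α₀ + α₁)) with hK_def
  have hKK₀ : K = K₀ * (α₀ + α₁) := by rw [hK_def, hK₀_def]; ring
  have hS0 : 0 < α₀ + α₁ := add_pos hα₀ hα₁
  have hKpos : 0 < K := by rw [hKK₀]; exact mul_pos hK₀ hS0
  have hα₀P : α₀ ≤ cP := by linarith only [hα₁, hs, min_le_left cP (cP / K₀)]
  have hKP : K ≤ cP := by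
    have h1 : α₀ + α₁ ≤ cP / K₀ := hs.trans (min_le_right _ _)
    calc K = K₀ * (α₀ + α₁) := hKK₀
      _ ≤ K₀ * (cP / K₀) := mul_le_mul_of_nonneg_left h1 hK₀.le
      _ = cP := by field_simp
  -- the datum is a datum of `SockB9P3D4` at level `m`
  have hWu : ∀ x κ, W x κ ∈ unitaryUnits 𝔸 := mem_unitaryUnits_of_mgauge_eq hU₀ hU' hu hW
  have h33m : InAk L m η α₀ Ω U₀ := fun j hj => h33 j (hj.trans hmk)
  have h34m : InAk L m η α₀ Ω (mulCfg W U₀) := by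
    have h1 : InAk L m η α₀ Ω (mulCfg U' U₀) := fun j hj => h34 j (hj.trans hmk)
    have hui : ∀ x, u⁻¹ x ∈ U1 𝔸 := fun x => unitaryUnits_le_U1 ((unitaryUnits 𝔸).inv_mem (hu x))
    rw [mulCfg_eq_gaugeAct_of_mgauge_eq hW]
    exact (B8Ineq132.inAk_gaugeAct_iff L m η α₀ Ω hui _).2 h1
  obtain ⟨ha, hg, -, -⟩ := H m hmk α₀ K hα₀ hα₀P hKpos hKP U₀ W hU₀ hWu h33m h34m hLan A' hsa hWA hA0
  exact ⟨ha, hg⟩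

/-- ★★ **THE `SH59D` BINDER OF dag-n05-e's CUBE-FAMILY CONSUMERS, SERVED FROM [4] THEOREM 3.3 BY NAME**: over the cube subtype of (1.131)
(`i.Ω = cubeFam false L a M ρ i.k`, `i.Λs = cubeLamS …`, `i.Λb = cubeLamB …`, `L ≤ ρ ≤ M`, `11d < M`, `L ≤ dM`) — the index of
`B8LeafModelZd3Bdry.thm4Printed_zd3_map_bdry` ∕ `B8Prop6CubeMemberGaugedBdry.prop6Printed_zdCub_bdry₅` — `B9.Thm33Printed` + `DictGlob` + `Prop6Feed` + the four
E(Ω₀)-binders give `B₀′`, `B_∂ = (20d+2)B₀′` and a threshold `c59 > 0` such that THAT binder holds with `(B₀, B₀′, Bbd, cP) := (B₀′, B₀″, (20d+2)B₀′, c59)` for any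
`B₀″ ≥ 0` (the cube families have `Margin2`: `R₁M₁ = ρ ≥ L ≥ 2`, `margin2_cubeFam`).  The consumer's window `4B_∂ ≤ (dL − 1)B₀′` then reads `80d + 8 ≤ dL − 1`.
[cite: Balaban1985RegularSpaces, Thm 4 p.88, Prop. 6 p.99, (1.131)–(1.133) p.99, (1.59) p.86; Balaban1985BackgroundPropagators, Thm 3.3 p.399] -/
theorem sh59D_cubeSubfamily_of_thm33 (hd2 : 2 ≤ d) {L : ℕ} (hL : 2 ≤ L)
    {I : Type} (geo : I → B9.Geometry) (bg : I → B9.Backgrounds) (GA : ∀ i, B9.KernelFamily (geo i) (bg i))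
    (mem : ℝ → ZdIdx d L → ℕ → I)
    (ιCfg : ∀ (M : ℝ) (i : ZdIdx d L) (m : ℕ) (U₀ : Site d → Fin d → 𝔸ˣ), (∀ x κ, U₀ x κ ∈ unitaryUnits 𝔸) → (bg (mem M i m)).Cfg)
    (ιLoc : ∀ (M : ℝ) (i : ZdIdx d L) (m : ℕ), (Site d → Fin d → 𝔸) → (geo (mem M i m)).Loc)
    (ops : ℝ → ZdIdx d L → ℕ → OpsZd d 𝔸) {c35 c₆ K₆ M₃ a₃ c69 q : ℝ}
    {Gp : ∀ i, B9.KernelFamily (geo i) (bg i)} (h33 : B9.Thm33Printed c35 geo bg Gp GA)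
    (hdict : DictGlob geo bg GA L mem ιCfg ιLoc ops) (hP6 : Prop6Feed bg L mem ιCfg c35 M₃ c₆ K₆)
    (hinv : InvOnDom bg L mem ιCfg ops c35 M₃ a₃) (hcurv : CurvSmallDom bg L mem ιCfg ops c35 M₃ a₃ c69)
    (hlan : LandauKillsDom bg L mem ιCfg ops c35 M₃ a₃) (havg : AvgBoundDom L ops q)
    (hc₆ : 0 < c₆) (hK₆ : 0 < K₆) (ha₃ : 0 < a₃) (hc69 : 0 ≤ c69) (hq : 0 ≤ q) {B₀'' : ℝ} (hB₀'' : 0 ≤ B₀'') :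
    ∃ B₀ c59 : ℝ, 0 < B₀ ∧ 0 < c59 ∧
    ∀ i : {i : ZdIdx d L // ∃ (a : Site d) (M ρ : ℕ), L ≤ ρ ∧ ρ ≤ M ∧ 11 * d < M ∧ L ≤ d * M ∧
        i.Ω = cubeFam false L a M ρ i.k ∧ i.Λs = cubeLamS L a M ρ i.k ∧ i.Λb = cubeLamB L a M ρ i.k},
      (∀ α₀ α₁ : ℝ, 0 < α₀ → 0 < α₁ → α₀ + α₁ ≤ c59 →
        ∀ U₀ U' : Site d → Fin d → 𝔸ˣ, (∀ x κ, U₀ x κ ∈ unitaryUnits 𝔸) → (∀ x κ, U' x κ ∈ unitaryUnits 𝔸) →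
        InAk L i.1.k i.1.η α₀ i.1.Ω U₀ → InAk L i.1.k i.1.η α₀ i.1.Ω (mulCfg U' U₀) → (∀ m, m ≤ i.1.k → InAx L m (i.1.Λs m) U₀ (mulCfg U' U₀)) →
        (∀ j, j ≤ i.1.k → ∀ (z : Site d) (μ : Fin d), (∀ x, InBox (loK L j z) (bondHiK L j z μ) x → x ∈ i.1.Ω j) →
          ‖(avgIter L (mulCfg U' U₀) j z μ : 𝔸) - (avgIter L U₀ j z μ : 𝔸)‖ ≤ α₁) →
        (∀ b ∈ {b : Site d × Fin d | SideTouches (i.1.Ω 0) b.1 b.2}, ‖((U' b.1 b.2 : 𝔸ˣ) : 𝔸) - 1‖ ≤ α₁) →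
        (∀ m, 1 ≤ m → m ≤ i.1.k → ∀ (u : Site d → 𝔸ˣ) (W : Site d → Fin d → 𝔸ˣ) (A' : Site d → Fin d → 𝔸),
          (∀ x, u x ∈ unitaryUnits 𝔸) → (∀ x, x ∉ i.1.Ω 0 → u x = 1) → mgauge U₀ u W = U' → Restr129 L m (i.1.Λs m) U₀ u →
          IsLandau138W L m i.1.η (i.1.Ω 0) (i.1.Λs m) U₀ W → (∀ y τ, IsSelfAdjoint (A' y τ)) →
          (∀ j, j ≤ m → ∀ y τ, SideTouches (i.1.Ω j) y τ →
          W y τ = cfgExp i.1.η A' y τ ∧ ‖A' y τ‖ ≤ (2 * (L * (5 * (d : ℝ) * L * (max 1 (2 * B₀ * max 1 q)) * (α₀ + α₁))) + 8 * (8 * B₀'' * (5 * (d : ℝ) * L * (max 1 (2 * B₀ * max 1 q))) * (α₀ + α₁))) * ((L : ℝ) ^ j * i.1.η)⁻¹) →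
          (∀ y τ, (∀ j, j ≤ m → ¬ SideTouches (i.1.Ω j) y τ) → A' y τ = 0) →
          msup L m i.1.η (-(1 : ℝ)) (fun j (b : Site d × Fin d) => SideTouches (i.1.Ω j) b.1 b.2) (fun b => A' b.1 b.2)
          ≤ (max 1 (2 * B₀ * max 1 q)) * (bondNorm L m i.1.η (-(3 : ℝ)) i.1.Ω (fun x μ => Jcur i.1.η U₀ A' μ x)
          + wsup 1 (fun p : {p : ℕ × (Site d × Fin d) // p.1 ≤ m ∧ p.2 ∈ i.1.Λb m p.1} =>
          linCovIter L U₀ (iEta i.1.η A') p.1.1 p.1.2.1 p.1.2.2))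
          + ((20 * d + 2) * max 1 (2 * B₀ * max 1 q)) * msup L m i.1.η (-(1 : ℝ)) (fun j (b : Site d × Fin d) => j = 0 ∧ SideTouches (i.1.Ω 0) b.1 b.2 ∧ ¬ BondTouches (i.1.Ω 0) b.1 b.2)
              (fun b => A' b.1 b.2) ∧
          msup L m i.1.η (-(2 : ℝ)) (fun j (t : Fin d × Fin d × Site d) => SideTouches (i.1.Ω j) t.2.2 t.2.1)
          (fun t => covDerivFwd i.1.η U₀ t.1 (fun z => A' z t.2.1) t.2.2)
          ≤ (max 1 (2 * B₀ * max 1 q)) * (bondNorm L m i.1.η (-(3 : ℝ)) i.1.Ω (fun x μ => Jcur i.1.η U₀ A' μ x)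
          + wsup 1 (fun p : {p : ℕ × (Site d × Fin d) // p.1 ≤ m ∧ p.2 ∈ i.1.Λb m p.1} =>
          linCovIter L U₀ (iEta i.1.η A') p.1.1 p.1.2.1 p.1.2.2))
          + ((20 * d + 2) * max 1 (2 * B₀ * max 1 q)) * msup L m i.1.η (-(1 : ℝ)) (fun j (b : Site d × Fin d) => j = 0 ∧ SideTouches (i.1.Ω 0) b.1 b.2 ∧ ¬ BondTouches (i.1.Ω 0) b.1 b.2)
              (fun b => A' b.1 b.2))) := by
  have hL1 : 1 ≤ L := le_trans (by norm_num) hL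
  have hd1 : 1 ≤ d := le_trans (by norm_num) hd2
  -- the cube members have `Margin2` (ρ ≥ L ≥ 2)
  have hMJ : ∀ i : {i : ZdIdx d L // ∃ (a : Site d) (M ρ : ℕ), L ≤ ρ ∧ ρ ≤ M ∧ 11 * d < M ∧ L ≤ d * M ∧
      i.Ω = cubeFam false L a M ρ i.k ∧ i.Λs = cubeLamS L a M ρ i.k ∧ i.Λb = cubeLamB L a M ρ i.k}, Margin2 i.1.Ω := by
    rintro ⟨i, a, M, ρ, hρ, -, -, -, hΩ, -, -⟩
    dsimp only
    rw [hΩ]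
    exact B9SupplySockB9P3ZdLettersOmega.margin2_cubeFam L a M (hL.trans hρ) i.k
  obtain ⟨B₀, cP, hB₀, hcP, hall⟩ := sockB9P3D4_allLevels_of_thm33 geo bg GA L mem ιCfg ιLoc ops hd2 hL1 h33 hdict hP6 hinv hcurv hlan havg
    hc₆ hK₆ ha₃ hc69 hq (fun i : {i : ZdIdx d L // ∃ (a : Site d) (M ρ : ℕ), L ≤ ρ ∧ ρ ≤ M ∧ 11 * d < M ∧ L ≤ d * M ∧
      i.Ω = cubeFam false L a M ρ i.k ∧ i.Λs = cubeLamS L a M ρ i.k ∧ i.Λb = cubeLamB L a M ρ i.k} => i.1) hMJ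
  have hB' : 0 < max 1 (2 * B₀ * max 1 q) := lt_of_lt_of_le one_pos (le_max_left _ _)
  refine ⟨B₀, min cP (cP / (2 * (L * (5 * (d : ℝ) * L * max 1 (2 * B₀ * max 1 q))) +
      8 * (8 * B₀'' * (5 * (d : ℝ) * L * max 1 (2 * B₀ * max 1 q))))), hB₀, ?_, fun i => ?_⟩
  · refine lt_min hcP (div_pos hcP ?_)
    have h1 : 0 < 2 * (L * (5 * (d : ℝ) * L * max 1 (2 * B₀ * max 1 q))) := by
      have : (0 : ℝ) < L := by exact_mod_cast (lt_of_lt_of_le one_pos hL1)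
      have : (0 : ℝ) < d := by exact_mod_cast (lt_of_lt_of_le one_pos hd1)
      positivity
    have h2 : 0 ≤ 8 * (8 * B₀'' * (5 * (d : ℝ) * L * max 1 (2 * B₀ * max 1 q))) := by positivity
    linarith
  · exact sockH59D_of_allLevelsD4 hd1 hL1 hB' hB₀'' hcP (fun m hm => hall i m hm)

end Bridge

#print axioms sockB9P3D4_at
#print axioms sockB9P3_at_univ
#print axioms sockB9P3D4_allLevels_of_thm33
#print axioms sockB9P3_allLevels_of_thm33_univ
#print axioms sockH59D_of_allLevelsD4
#print axioms sh59D_cubeSubfamily_of_thm33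

end Literature.MathematicalPhysics.QuantumFieldTheory.Balaban1983to89.B9SupplySockB9P3ZdOmega

end
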